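import Summits.BirchSwinnertonDyer.BirchSwinnertonDyer.Theorems.ManinLocalTwoThreePinningFourHundred
import Summits.BirchSwinnertonDyer.BirchSwinnertonDyer.Theorems.ManinLocalTwoThreePinningKernelRows
import Summits.BirchSwinnertonDyer.BirchSwinnertonDyer.Theorems.ManinLocalTwoThreeEtaCertificateSparse
import Summits.BirchSwinnertonDyer.BirchSwinnertonDyer.Theorems.ManinLocalTwoThreeOddTwistRootFormTransport
import Summits.BirchSwinnertonDyer.BirchSwinnertonDyer.Theorems.ManinLocalTwoThreeRootFormsEightyNeron
import Literature.NumberTheory.EllipticCurves.CuspFormTwist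
import Literature.NumberTheory.EllipticCurves.RootNumberTwistProofs
import HarnessLib

/-!
# Level 400, the classes `80a ⊗ χ₅` and `80b ⊗ χ₅`: `|c| = 1` UNCONDITIONALLY, by the odd-twist root-form transport at `p = 5`

Cell bsd-f2-manin, route `ManinLocalTwoThree` (crux C2 `ManinOddAtFour`, stmt-BirchSwinnertonDyer-22967; `--supports` helper), LEAD p1 gen 27.
Level `400 = 2⁴·5²` has eight newform classes (an g57's cusp-space kernel pinning `…PinningFourHundred`, 11 files landed by this seat; `goodCerts` =
eight certificates, `a₃ ∈ {−3, −2, −2, −1, 0, 1, 2, 3}`); the kernel census (`p1 g27 scripts/census.py`: `d′·χ(n)·aₙ(root) = Σ_j y_j·tabs_j[n]`, `n < 192`)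
finds exactly two twists of COMPLETE roots by a character of odd prime conductor: the row with `a₃ = 0` is `80a ⊗ χ₅` and the row with
`(a₃, a₇) = (−2, 2)` is `80b ⊗ χ₅` (`χ₅ = (·/5)`; the others are `50a/50b/200b ⊗ χ₋₄/χ₋₂₀` or twist-minimal).  This file closes those two classes on
the template of LEAD g26's `…ManinConstantTwoHundredC` (`200c = 40a ⊗ χ₅`):

* §1 THE ROWS: the twisted tables `tabTC = χ₅·tEightyB`, `tabTE = χ₅·tEightyA` to depth `145` (`≥ 144` = the dual support of an's kernel; LEAD g26's
  root tables `RootFormsEighty.tEightyA/B`), the integer row identities (kernel `decide`), an g55's row lemma `eq_of_smul_eq_sum_of_row` in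
  `V = S₂(Γ₀(400))` (`dim = 43`, `coef = cuspCoeffₗ`): `f_cases (D)`, and the selections `f_eq_charTwist_phiEightyA_of_lFunction_three`
  (`a₃(W) = 0`), `f_eq_charTwist_phiEightyB_of_lFunction_three_seven` (`a₃(W) = −2`, `a₇(W) = 2`).
* §2 THE HEADLINES by p3's engine `OddTwistRootForm.abs_maninConstant_eq_one_of_rootForm_charTwist_eq` (`p = 5`, `M = 80 ∣ 400`, `5² ∣ 400`):
  root packages `exists_neron_squeeze_phiEightyA/B` + `hasMultiplicativeReductionAtPrime_five_eightyA1/B1` (`…RootFormsEightyNeron`):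
  **`abs_maninConstant_eq_one_fourHundred_of_lFunction_three_eq_zero`**, **`abs_maninConstant_eq_one_fourHundred_of_lFunction_three_seven`**,
  `2 ∤ c` and `5 ∤ c` there.

HONEST FRAMING: unconditional (standard axioms); TWO of the eight classes of level 400 (the other six are not twists of complete roots by an
odd-conductor character); no root datum, no modularity input, no CDT, no printed Manin fact; nothing here proves C2/C3, Manin's conjecture or BSD.
[cite: CremonaAlgorithms1997, §2.10, Table 1 (N = 80, 400)] [cite: Shimura1971, Prop. 3.64] [cite: Stevens1989, Lemma (5.2) p. 96, Lemma (5.4) p. 97]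
[cite: AgasheRibetStein2006, §§1–2]
-/

set_option autoImplicit false
-- lint-debt: the directory name repeats the summit name (sibling precedent `ManinLocalTwoThreeManinConstantTwoHundredC.lean`)
set_option linter.dupNamespace false

noncomputable section

open Complex
open UpperHalfPlane hiding I
open scoped MatrixGroups ModularForm
open ModularForm CongruenceSubgroup PowerSeries
open Literature.NumberTheory.ModularForms
open Literature.NumberTheory.EllipticCurves Literature.NumberTheory.EllipticCurves.ModularForms

namespace Summit.BirchSwinnertonDyer.BirchSwinnertonDyer.Theorems.ManinLocalTwoThree.LevelFourHundred

open Summit.BirchSwinnertonDyer.BirchSwinnertonDyer.Theorems.ManinLocalTwoThree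
open Summit.BirchSwinnertonDyer.BirchSwinnertonDyer.Theorems
open BracketSturm PinningKernel PinningFourHundred OddTwistRootForm RootFormsEighty LevelEighty

set_option maxHeartbeats 4000000
set_option maxRecDepth 16384

variable {W : WeierstrassCurve ℚ} [W.IsElliptic]

/-! ## §1 The rows of level `400` and the two twisted root tables -/

/-- The `goodCerts` row `400a` (`(a₃, a₇, a₁₁) = (-3, 2, -1)`, `d′ = 1`). [folklore] -/
def rowA : List (ℕ × ℤ) × ℤ × List ℤ :=
  ([(2, 0), (5, 0), (3, -3), (7, 2), (11, -1), (13, -4), (17, -5)], 1, [0, 0, 2, -8, 0, 0, -1, 1, 0, 0, 0, 0, 1, -1, -2, 4, -3, 6, 2, -1, 0, 0, -3, 3, 0, 0, 1, -1, 0, 0, 0, 0, 0, 0, 0, 0, 4, -4, 0, 0, 0, 0, 0])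

/-- The `goodCerts` row `400b` (`(a₃, a₇, a₁₁) = (-2, -2, 4)`, `d′ = 1`). [folklore] -/
def rowB : List (ℕ × ℤ) × ℤ × List ℤ :=
  ([(2, 0), (5, 0), (3, -2), (7, -2), (11, 4), (13, 4), (17, 0)], 1, [4, 20, 2, 8, 0, 0, -6, -6, 0, 0, -2, -2, -1, -1, 2, 4, -2, -4, 8, 4, 0, 0, 2, 2, 0, 0, -3, -3, -2, -8, 0, 0, 0, 0, 0, 0, -4, -4, 0, 0, 12, 4, 4])

/-- The `goodCerts` row `400c` (`(a₃, a₇, a₁₁) = (-2, 2, 0)`, `d′ = 1`) — the class `80b ⊗ χ₅`. [folklore] -/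
def rowC : List (ℕ × ℤ) × ℤ × List ℤ :=
  ([(2, 0), (5, 0), (3, -2), (7, 2), (11, 0), (13, -2), (17, 6)], 1, [0, 0, 0, 0, 0, 0, 2, 2, 0, 0, 0, 0, 1, 1, 0, 0, 2, 4, -4, -2, 0, 0, -2, -2, 0, 0, 1, 1, 0, 0, 0, 0, 0, 0, 0, 0, 0, 0, 0, 0, 0, 0, 0])

/-- The `goodCerts` row `400d` (`(a₃, a₇, a₁₁) = (-1, -2, 3)`, `d′ = 1`). [folklore] -/
def rowD : List (ℕ × ℤ) × ℤ × List ℤ :=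
  ([(2, 0), (5, 0), (3, -1), (7, -2), (11, 3), (13, -4), (17, -3)], 1, [0, 0, 0, 0, 0, 0, 1, -1, 0, 0, 0, 0, 1, -1, 0, 0, 1, -2, -2, 1, 0, 0, -1, 1, 0, 0, -1, 1, 0, 0, 0, 0, 0, 0, 0, 0, 0, 0, 0, 0, 0, 0, 0])

/-- The `goodCerts` row `400e` (`(a₃, a₇, a₁₁) = (0, -4, -4)`, `d′ = 1`) — the class `80a ⊗ χ₅`. [folklore] -/
def rowE : List (ℕ × ℤ) × ℤ × List ℤ :=
  ([(2, 0), (5, 0), (3, 0), (7, -4), (11, -4), (13, 2), (17, -2)], 1, [0, 0, 2, -8, 0, 0, 2, -2, 0, 0, 0, 0, 1, -1, -2, 4, 0, 0, -4, 2, 0, 0, 0, 0, 0, 0, 1, -1, 0, 0, 0, 0, 0, 0, 0, 0, 4, -4, 0, 0, 0, 0, 0])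

/-- The `goodCerts` row `400f` (`(a₃, a₇, a₁₁) = (1, 2, 3)`, `d′ = 1`). [folklore] -/
def rowF : List (ℕ × ℤ) × ℤ × List ℤ :=
  ([(2, 0), (5, 0), (3, 1), (7, 2), (11, 3), (13, 4), (17, 3)], 1, [0, 0, 0, 0, 0, 0, -1, -1, 0, 0, 0, 0, 1, 1, 0, 0, -1, -2, 2, 1, 0, 0, 1, 1, 0, 0, 1, 1, 0, 0, 0, 0, 0, 0, 0, 0, 0, 0, 0, 0, 0, 0, 0])

/-- The `goodCerts` row `400g` (`(a₃, a₇, a₁₁) = (2, 2, 4)`, `d′ = 1`). [folklore] -/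
def rowG : List (ℕ × ℤ) × ℤ × List ℤ :=
  ([(2, 0), (5, 0), (3, 2), (7, 2), (11, 4), (13, -4), (17, 0)], 1, [-4, -20, -2, -8, 0, 0, 6, 6, 0, 0, 2, 2, 3, 3, -2, -4, 2, 4, -8, -4, 0, 0, -2, -2, 0, 0, 1, 1, 2, 8, 0, 0, 0, 0, 0, 0, 4, 4, 0, 0, -12, -4, -4])

/-- The `goodCerts` row `400h` (`(a₃, a₇, a₁₁) = (3, -2, -1)`, `d′ = 3`). [folklore] -/
def rowH : List (ℕ × ℤ) × ℤ × List ℤ :=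
  ([(2, 0), (5, 0), (3, 3), (7, -2), (11, -1), (13, 4), (17, 5)], 3, [-24, -120, -6, -24, 0, 0, 23, 23, 0, 0, 8, 8, 3, 3, -6, -12, 9, 18, -30, -15, 0, 0, -3, -3, 0, 0, 9, 9, 12, 48, 4, 8, 0, 0, 0, 0, 12, 12, 0, 0, -68, -16, -24])

/-- `goodCerts` is literally the list of the eight rows. [folklore] -/
theorem goodCerts_eq_rows : goodCerts = [rowA, rowB, rowC, rowD, rowE, rowF, rowG, rowH] := rfl

/-- The stage primes. [folklore] -/
theorem stages_map_fst : stages.map Prod.fst = [2, 5, 3, 7, 11, 13, 17] := by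
  decide

/-- `(n/5)·aₙ(φ₈₀ᵦ)` to depth `145` — the row `400c` (`80b ⊗ χ₅`). [cite: CremonaAlgorithms1997, Table 1 (N = 400)] -/
def tabTC : List ℤ :=
  [0, 1, 0, -2, 0, 0, 0, 2, 0, 1, 0, 0, 0, -2, 0, 0, 0, 6, 0, 4, 0, -4, 0, 6, 0, 0, 0, 4, 0, 6, 0, 4, 0, 0, 0, 0, 0, -2, 0, 4, 0, 6, 0, -10, 0, 0, 0,
  -6, 0, -3, 0, -12, 0, 6, 0, 0, 0, -8, 0, -12, 0, 2, 0, 2, 0, 0, 0, 2, 0, -12, 0, 12, 0, -2, 0, 0, 0, 0, 0, -8, 0, -11, 0, 6, 0, 0, 0, -12, 0, -6,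
  0, -4, 0, -8, 0, 0, 0, -2, 0, 0, 0, 6, 0, 14, 0, 0, 0, -6, 0, 2, 0, 4, 0, 6, 0, 0, 0, -2, 0, 12, 0, -11, 0, -12, 0, 0, 0, 2, 0, 20, 0, 0, 0, 8, 0,
  0, 0, -18, 0, 4, 0, 12, 0, 0, 0]

/-- `(n/5)·aₙ(φ₈₀ₐ)` to depth `145` — the row `400e` (`80a ⊗ χ₅`). [cite: CremonaAlgorithms1997, Table 1 (N = 400)] -/
def tabTE : List ℤ :=
  [0, 1, 0, 0, 0, 0, 0, -4, 0, -3, 0, -4, 0, 2, 0, 0, 0, -2, 0, -4, 0, 0, 0, 4, 0, 0, 0, 0, 0, -2, 0, 8, 0, 0, 0, 0, 0, -6, 0, 0, 0, -6, 0, -8, 0, 0,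
  0, 4, 0, 9, 0, 0, 0, -6, 0, 0, 0, 0, 0, 4, 0, -2, 0, 12, 0, 0, 0, 8, 0, 0, 0, 0, 0, 6, 0, 0, 0, 16, 0, 0, 0, 9, 0, -16, 0, 0, 0, 0, 0, -6, 0, -8,
  0, 0, 0, 0, 0, 14, 0, 12, 0, 6, 0, 4, 0, 0, 0, 0, 0, 14, 0, 0, 0, -18, 0, 0, 0, -6, 0, 8, 0, 5, 0, 0, 0, 0, 0, -12, 0, 0, 0, -12, 0, 16, 0, 0, 0,
  -10, 0, -12, 0, 0, 0, -8, 0]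

/-- `tabTC[n] = (n/5)·tEightyB[n]`, `n < 145`. [folklore] -/
theorem hTwC : ∀ n < 145, tabTC.getD n 0 = legendreSym 5 n * tEightyB.getD n 0 := by
  decide +kernel

/-- `tabTE[n] = (n/5)·tEightyA[n]`, `n < 145`. [folklore] -/
theorem hTwE : ∀ n < 145, tabTE.getD n 0 = legendreSym 5 n * tEightyA.getD n 0 := by
  decide +kernel

/-- **Row identity `400c`**: `d′·tabTC[n] = Σ_j y_j·tabs_j[n]`, `n < 145`. [folklore] -/
theorem hrowC : ∀ n < 145, rowC.2.1 * tabTC.getD n 0 = ∑ j : Fin 43, rowC.2.2.getD (j : ℕ) 0 * (tabs j).getD n 0 := by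
  decide +kernel

/-- **Row identity `400e`**: `d′·tabTE[n] = Σ_j y_j·tabs_j[n]`, `n < 145`. [folklore] -/
theorem hrowE : ∀ n < 145, rowE.2.1 * tabTE.getD n 0 = ∑ j : Fin 43, rowE.2.2.getD (j : ℕ) 0 * (tabs j).getD n 0 := by
  decide +kernel

/-- `aₙ(φ₈₀ᵦ ⊗ χ₅) = tabTC[n]`, `n < 145`, read by the coefficient functionals of `S₂(Γ₀(400))`. [cite: Shimura1971, Prop. 3.64] -/
theorem tabTC_eq_cuspCoeff [Fact (Nat.Prime 5)] : ∀ n < 145, ((tabTC.getD n 0 : ℤ) : ℂ) =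
    cuspCoeffₗ (one_mem_strictPeriods_coe_gamma0 400) n (charTwist 400 (⟨5, rfl⟩ : 80 ∣ 400) (⟨16, rfl⟩ : 5 ^ 2 ∣ 400) (isQuadratic_quadraticChar_ringHomComp 5) phiEightyB) := by
  intro n hn
  have hc : ((tabTC.getD n 0 : ℤ) : ℂ) = ((legendreSym 5 n : ℤ) : ℂ) * ((tEightyB.getD n 0 : ℤ) : ℂ) := by exact_mod_cast hTwC n hn
  rw [cuspCoeffₗ_apply, cuspCoeff_charTwist 400 _ _ (isQuadratic_quadraticChar_ringHomComp 5)
    (isPrimitive_quadraticChar_ringHomComp 5 (by norm_num)), quadraticChar_ringHomComp_apply_natCast, ← tEightyB_eq_cuspCoeff n hn]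
  exact hc

/-- `aₙ(φ₈₀ₐ ⊗ χ₅) = tabTE[n]`, `n < 145`. [cite: Shimura1971, Prop. 3.64] -/
theorem tabTE_eq_cuspCoeff [Fact (Nat.Prime 5)] : ∀ n < 145, ((tabTE.getD n 0 : ℤ) : ℂ) =
    cuspCoeffₗ (one_mem_strictPeriods_coe_gamma0 400) n (charTwist 400 (⟨5, rfl⟩ : 80 ∣ 400) (⟨16, rfl⟩ : 5 ^ 2 ∣ 400) (isQuadratic_quadraticChar_ringHomComp 5) phiEightyA) := by
  intro n hn
  have hc : ((tabTE.getD n 0 : ℤ) : ℂ) = ((legendreSym 5 n : ℤ) : ℂ) * ((tEightyA.getD n 0 : ℤ) : ℂ) := by exact_mod_cast hTwE n hn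
  rw [cuspCoeffₗ_apply, cuspCoeff_charTwist 400 _ _ (isQuadratic_quadraticChar_ringHomComp 5)
    (isPrimitive_quadraticChar_ringHomComp 5 (by norm_num)), quadraticChar_ringHomComp_apply_natCast, ← tEightyA_eq_cuspCoeff n hn]
  exact hc

/-- **LEVEL 400: THE ROWS.**  For every `X₀(400)`-datum `D` of an elliptic `W/ℚ`: the sieve truth row is one of the eight certificates; on the
third (`(a₃, a₇) = (−2, 2)`) the newform is the EXPLICIT twist `φ₈₀ᵦ ⊗ χ₅`, on the fifth (`a₃ = 0`) it is `φ₈₀ₐ ⊗ χ₅` — no root datum, no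
modularity input. [cite: CremonaAlgorithms1997, §2.10, Table 1 (N = 400)] [cite: Shimura1971, Prop. 3.64] -/
theorem f_cases [Fact (Nat.Prime 5)] (D : ModularParametrizationData W 400) :
    truth W [2, 5, 3, 7, 11, 13, 17] = rowA.1 ∨
    truth W [2, 5, 3, 7, 11, 13, 17] = rowB.1 ∨
    (truth W [2, 5, 3, 7, 11, 13, 17] = rowC.1 ∧
      D.f = charTwist 400 (⟨5, rfl⟩ : 80 ∣ 400) (⟨16, rfl⟩ : 5 ^ 2 ∣ 400) (isQuadratic_quadraticChar_ringHomComp 5) phiEightyB) ∨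
    truth W [2, 5, 3, 7, 11, 13, 17] = rowD.1 ∨
    (truth W [2, 5, 3, 7, 11, 13, 17] = rowE.1 ∧
      D.f = charTwist 400 (⟨5, rfl⟩ : 80 ∣ 400) (⟨16, rfl⟩ : 5 ^ 2 ∣ 400) (isQuadratic_quadraticChar_ringHomComp 5) phiEightyA) ∨
    truth W [2, 5, 3, 7, 11, 13, 17] = rowF.1 ∨
    truth W [2, 5, 3, 7, 11, 13, 17] = rowG.1 ∨
    truth W [2, 5, 3, 7, 11, 13, 17] = rowH.1 := by
  haveI : FiniteDimensional ℂ (CuspForm (Gamma0 400) 2) := finiteDimensional_cuspForm_gamma0 400 2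
  have hlen : ∀ i : Fin 43, (duals i).length ≤ 145 := by decide +kernel
  obtain ⟨S, C, hCS, hC, c, hc, htruth, hpinS, -⟩ := pinning_cusp D
  have ht := tables_of_etaCertsSparse 400 192 (fun i : Fin 43 ↦ expFn (Ls[(i : ℕ)]).1) (fun i ↦ shifts i) tabs C hC hshift hcert
  have htS : ∀ i, ∀ n < 145, (((tabs i).getD n 0 : ℤ) : ℂ) = cuspCoeffₗ (one_mem_strictPeriods_coe_gamma0 400) n (S i) :=
    fun i n hn ↦ by rw [cuspCoeffₗ_apply, ← modCoefₗ_modularForm (S i) n, hCS]; exact ht i n (by omega)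
  rw [stages_map_fst] at htruth
  rw [goodCerts_eq_rows] at hc
  simp only [List.mem_cons, List.mem_nil_iff, or_false] at hc
  rcases hc with rfl | rfl | rfl | rfl | rfl | rfl | rfl | rfl
  · exact Or.inl htruth
  · exact Or.inr (Or.inl htruth)
  · exact Or.inr (Or.inr (Or.inl ⟨htruth, eq_of_smul_eq_sum_of_row S tabs duals 720 htS hlen hdual (by norm_num) finrank_cuspForm_two _
      tabTC tabTC_eq_cuspCoeff rowC.2.1 (by decide) rowC.2.2 hpinS hrowC⟩))
  · exact Or.inr (Or.inr (Or.inr (Or.inl htruth)))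
  · exact Or.inr (Or.inr (Or.inr (Or.inr (Or.inl ⟨htruth, eq_of_smul_eq_sum_of_row S tabs duals 720 htS hlen hdual (by norm_num) finrank_cuspForm_two _
      tabTE tabTE_eq_cuspCoeff rowE.2.1 (by decide) rowE.2.2 hpinS hrowE⟩))))
  · exact Or.inr (Or.inr (Or.inr (Or.inr (Or.inr (Or.inl htruth)))))
  · exact Or.inr (Or.inr (Or.inr (Or.inr (Or.inr (Or.inr (Or.inl htruth))))))
  · exact Or.inr (Or.inr (Or.inr (Or.inr (Or.inr (Or.inr (Or.inr (htruth)))))))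

omit [W.IsElliptic] in
/-- The `a₃`/`a₇` entries of the truth row. [folklore] -/
theorem key_truth (row : List (ℕ × ℤ) × ℤ × List ℤ) (h : truth W [2, 5, 3, 7, 11, 13, 17] = row.1) :
    W.LFunction 3 = (row.1.getD 2 (0, 0)).2 ∧ W.LFunction 7 = (row.1.getD 3 (0, 0)).2 :=
  ⟨by simpa [truth] using congrArg (fun l : List (ℕ × ℤ) ↦ (l.getD 2 (0, 0)).2) h,
   by simpa [truth] using congrArg (fun l : List (ℕ × ℤ) ↦ (l.getD 3 (0, 0)).2) h⟩

/-- **The row selected by `a₃(W) = 0`**: `D.f = φ₈₀ₐ ⊗ χ₅`. [cite: CremonaAlgorithms1997, Table 1 (N = 400)] -/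
theorem f_eq_charTwist_phiEightyA_of_lFunction_three [Fact (Nat.Prime 5)] (D : ModularParametrizationData W 400) (h3 : W.LFunction 3 = 0) :
    D.f = charTwist 400 (⟨5, rfl⟩ : 80 ∣ 400) (⟨16, rfl⟩ : 5 ^ 2 ∣ 400) (isQuadratic_quadraticChar_ringHomComp 5) phiEightyA := by
  have key := key_truth (W := W)
  rcases f_cases D with h | h | ⟨h, hf⟩ | h | ⟨h, hf⟩ | h | h | h
  · have h' := (key rowA h).1; rw [h3] at h'; simp [rowA] at h'
  · have h' := (key rowB h).1; rw [h3] at h'; simp [rowB] at h'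
  · have h' := (key rowC h).1; rw [h3] at h'; simp [rowC] at h'
  · have h' := (key rowD h).1; rw [h3] at h'; simp [rowD] at h'
  · exact hf
  · have h' := (key rowF h).1; rw [h3] at h'; simp [rowF] at h'
  · have h' := (key rowG h).1; rw [h3] at h'; simp [rowG] at h'
  · have h' := (key rowH h).1; rw [h3] at h'; simp [rowH] at h'

/-- **The row selected by `a₃(W) = −2`, `a₇(W) = 2`**: `D.f = φ₈₀ᵦ ⊗ χ₅`. [cite: CremonaAlgorithms1997, Table 1 (N = 400)] -/
theorem f_eq_charTwist_phiEightyB_of_lFunction_three_seven [Fact (Nat.Prime 5)] (D : ModularParametrizationData W 400)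
    (h3 : W.LFunction 3 = -2) (h7 : W.LFunction 7 = 2) :
    D.f = charTwist 400 (⟨5, rfl⟩ : 80 ∣ 400) (⟨16, rfl⟩ : 5 ^ 2 ∣ 400) (isQuadratic_quadraticChar_ringHomComp 5) phiEightyB := by
  have key := key_truth (W := W)
  rcases f_cases D with h | h | ⟨h, hf⟩ | h | ⟨h, hf⟩ | h | h | h
  · have h' := (key rowA h).1; rw [h3] at h'; simp [rowA] at h'
  · have h' := (key rowB h).2; rw [h7] at h'; simp [rowB] at h'
  · exact hf
  · have h' := (key rowD h).1; rw [h3] at h'; simp [rowD] at h'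
  · have h' := (key rowE h).1; rw [h3] at h'; simp [rowE] at h'
  · have h' := (key rowF h).1; rw [h3] at h'; simp [rowF] at h'
  · have h' := (key rowG h).1; rw [h3] at h'; simp [rowG] at h'
  · have h' := (key rowH h).1; rw [h3] at h'; simp [rowH] at h'

/-! ## §2 The headlines -/

/-- **`|c| = 1` ON THE CLASS `80a ⊗ χ₅` OF LEVEL 400, UNCONDITIONALLY**: for every globally minimal elliptic `W/ℚ` with `a₃(W) = 0` and every
`X₀(400)`-datum of `W` with the lattice clause `Λ_W = c·Λ_f`.  Row `D.f = φ₈₀ₐ ⊗ χ₅`, root squeeze `Λ(φ₈₀ₐ) ⊆ Λ_Néron(80a1)` (p2's level-80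
certificate, LEAD g26's datum-free root), `80a1` multiplicative at `5`, closed by p3's odd-twist ROOT-FORM transport at `p = 5`.
[cite: Stevens1989, Lemma (5.2) p. 96, Lemma (5.4) p. 97] [cite: AgasheRibetStein2006, §§1–2] [cite: CremonaAlgorithms1997, Table 1 (80a1), Table 1 (N = 400)] -/
theorem abs_maninConstant_eq_one_fourHundred_of_lFunction_three_eq_zero (W : WeierstrassCurve ℚ) [W.IsElliptic] [W.IsGloballyMinimal]
    (D : ModularParametrizationData W 400) (h3 : W.LFunction 3 = 0) (hopt : ∀ z ∈ D.L.lattice, ∃ w ∈ periodLattice D.f, z = D.c * w) :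
    |D.maninConstant| = 1 := by
  haveI h5 : Fact (Nat.Prime 5) := ⟨by norm_num⟩
  obtain ⟨L₀, hL₀, hle⟩ := exists_neron_squeeze_phiEightyA
  haveI := isElliptic_eightyA1
  haveI := isGloballyMinimal_eightyA1
  exact abs_maninConstant_eq_one_of_rootForm_charTwist_eq (p := 5) (by norm_num) (isQuadratic_quadraticChar_ringHomComp 5)
    (isPrimitive_quadraticChar_ringHomComp 5 (by norm_num)) phiEightyA (⟨0, 0, 0, -7, 6⟩ : WeierstrassCurve ℚ) L₀ hL₀ hle
    (Or.inr hasMultiplicativeReductionAtPrime_five_eightyA1) W D _ _ (f_eq_charTwist_phiEightyA_of_lFunction_three D h3) hopt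

/-- **`|c| = 1` ON THE CLASS `80b ⊗ χ₅` OF LEVEL 400, UNCONDITIONALLY** (`a₃(W) = −2`, `a₇(W) = 2`; root `80b1` multiplicative at `5`).
[cite: Stevens1989, Lemma (5.2) p. 96, Lemma (5.4) p. 97] [cite: AgasheRibetStein2006, §§1–2] [cite: CremonaAlgorithms1997, Table 1 (80b1), Table 1 (N = 400)] -/
theorem abs_maninConstant_eq_one_fourHundred_of_lFunction_three_seven (W : WeierstrassCurve ℚ) [W.IsElliptic] [W.IsGloballyMinimal]
    (D : ModularParametrizationData W 400) (h3 : W.LFunction 3 = -2) (h7 : W.LFunction 7 = 2)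
    (hopt : ∀ z ∈ D.L.lattice, ∃ w ∈ periodLattice D.f, z = D.c * w) :
    |D.maninConstant| = 1 := by
  haveI h5 : Fact (Nat.Prime 5) := ⟨by norm_num⟩
  obtain ⟨L₀, hL₀, hle⟩ := exists_neron_squeeze_phiEightyB
  haveI := AddPotGoodPrint.isElliptic_80b1
  haveI := AddPotGoodPrint.isGloballyMinimal_80b1
  exact abs_maninConstant_eq_one_of_rootForm_charTwist_eq (p := 5) (by norm_num) (isQuadratic_quadraticChar_ringHomComp 5)
    (isPrimitive_quadraticChar_ringHomComp 5 (by norm_num)) phiEightyB (⟨0, -1, 0, 4, -4⟩ : WeierstrassCurve ℚ) L₀ hL₀ hle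
    (Or.inr hasMultiplicativeReductionAtPrime_five_eightyB1) W D _ _ (f_eq_charTwist_phiEightyB_of_lFunction_three_seven D h3 h7) hopt

/-- **`|c| = 1` on the two transported classes of level 400** (`a₃ = 0`, or `(a₃, a₇) = (−2, 2)`). [cite: AgasheRibetStein2006, §§1–2] -/
theorem abs_maninConstant_eq_one_fourHundred_of_rowCE (W : WeierstrassCurve ℚ) [W.IsElliptic] [W.IsGloballyMinimal]
    (D : ModularParametrizationData W 400) (h : W.LFunction 3 = 0 ∨ (W.LFunction 3 = -2 ∧ W.LFunction 7 = 2))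
    (hopt : ∀ z ∈ D.L.lattice, ∃ w ∈ periodLattice D.f, z = D.c * w) : |D.maninConstant| = 1 := by
  rcases h with h3 | ⟨h3, h7⟩
  · exact abs_maninConstant_eq_one_fourHundred_of_lFunction_three_eq_zero W D h3 hopt
  · exact abs_maninConstant_eq_one_fourHundred_of_lFunction_three_seven W D h3 h7 hopt

/-- **No integer `q` with `|q| ≠ 1` — in particular neither `2` nor `5` — divides `c` on those two classes.** [folklore] -/
theorem not_dvd_maninConstant_fourHundred_of_rowCE (W : WeierstrassCurve ℚ) [W.IsElliptic] [W.IsGloballyMinimal]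
    (D : ModularParametrizationData W 400) (h : W.LFunction 3 = 0 ∨ (W.LFunction 3 = -2 ∧ W.LFunction 7 = 2))
    (hopt : ∀ z ∈ D.L.lattice, ∃ w ∈ periodLattice D.f, z = D.c * w) {q : ℤ} (hq : q.natAbs ≠ 1) : ¬ q ∣ D.maninConstant := by
  intro hd
  have h1 := abs_maninConstant_eq_one_fourHundred_of_rowCE W D h hopt
  have hn : D.maninConstant.natAbs = 1 := by
    rw [Int.abs_eq_natAbs] at h1
    exact_mod_cast h1
  have h2 : q.natAbs ∣ 1 := hn ▸ Int.natAbs_dvd_natAbs.mpr hd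
  exact hq (Nat.dvd_one.mp h2)

/-- **`2 ∤ c` on the two transported classes of level `400`** — the body of C2 `ManinOddAtFour` at `N = 400` for the curves with `a₃ = 0` or
`(a₃, a₇) = (−2, 2)`. [cite: AgasheRibetStein2006, §§1–2] -/
theorem not_two_dvd_maninConstant_fourHundred_of_rowCE (W : WeierstrassCurve ℚ) [W.IsElliptic] [W.IsGloballyMinimal]
    (D : ModularParametrizationData W 400) (h : W.LFunction 3 = 0 ∨ (W.LFunction 3 = -2 ∧ W.LFunction 7 = 2))
    (hopt : ∀ z ∈ D.L.lattice, ∃ w ∈ periodLattice D.f, z = D.c * w) : ¬ (2 : ℤ) ∣ D.maninConstant :=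
  not_dvd_maninConstant_fourHundred_of_rowCE W D h hopt (by decide)

/-- **`5 ∤ c` on the two transported classes of level `400`** (the residual conjunct's body at `p = 5`, `5² ∣ 400`, on these classes).
[cite: AgasheRibetStein2006, §§1–2] -/
theorem not_five_dvd_maninConstant_fourHundred_of_rowCE (W : WeierstrassCurve ℚ) [W.IsElliptic] [W.IsGloballyMinimal]
    (D : ModularParametrizationData W 400) (h : W.LFunction 3 = 0 ∨ (W.LFunction 3 = -2 ∧ W.LFunction 7 = 2))
    (hopt : ∀ z ∈ D.L.lattice, ∃ w ∈ periodLattice D.f, z = D.c * w) : ¬ (5 : ℤ) ∣ D.maninConstant :=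
  not_dvd_maninConstant_fourHundred_of_rowCE W D h hopt (by decide)

end Summit.BirchSwinnertonDyer.BirchSwinnertonDyer.Theorems.ManinLocalTwoThree.LevelFourHundred

end
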